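import Mathlib.Analysis.Complex.CauchyIntegral
import Mathlib.Analysis.Calculus.MeanValue
import Mathlib.MeasureTheory.Integral.IntervalIntegral.FundThmCalculus
import Mathlib.Analysis.SpecialFunctions.Integrals.Basic
import HarnessLib

/-!
# Gontcharoff's estimate for an entire function along a chain of zeros of its derivatives

Trunk T-ANALYSIS support (`Literature/Analysis/Complex`), serving the discharge of Kim's theorem
`Literature.Barriers.RiemannHypothesis.Farmer2022_kimTheorem` (Farmer 2022, §2; Kim 1996) along the
lines of Ki–Kim's proof of the Pólya–Wiman conjecture (Ki–Kim 2000, §2).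

**Ki–Kim 2000, §2, inequality (2.3)** (a special case of Gontcharoff 1930, [G, pp. 11–13]): let
`f` be entire and let `z₀, z₁, …, z_{n−1}` be complex numbers with `f^{(k)}(z_k) = 0`
(`0 ≤ k < n`). Then for every `z`,

  `|f(z)| ≤ (Mₙ / n!) · (|z − z₀| + |z₀ − z₁| + ⋯ + |z_{n−2} − z_{n−1}|)ⁿ`,

where `Mₙ` is the maximum modulus of `f^{(n)}` on a disc containing the broken line
`z, z₀, z₁, …, z_{n−1}` (Ki–Kim take the disc about `0` of radius
`|z| + |z − z₀| + ⋯ + |z_{n−2} − z_{n−1}|`). It follows from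
`f(z) = ∫_{z₀}^{z} ∫_{z₁}^{ζ₁} ⋯ ∫_{z_{n−1}}^{ζ_{n−1}} f^{(n)}(ζₙ) dζₙ ⋯ dζ₁`.

Here it is PROVED (`Literature.Analysis.Complex.gontcharoff_norm_le`) in the form: for any convex
set `K` containing `z` and the `z_k`, and any bound `‖f^{(n)}‖ ≤ M` on `K`, by induction on `n`:
`f(z) − f(z₀) = (z − z₀) ∫₀¹ f'(z₀ + t(z − z₀)) dt` and the inductive bound for `f'` along the
segment integrate to `∫₀¹ (td + c)^{n−1} dt ≤ (d + c)ⁿ/(n d)` (`norm_le_of_norm_deriv_le_segment`).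

## References

* H. Ki, Y.-O. Kim, *On the number of nonreal zeros of real entire functions and the Fourier–Pólya
  conjecture*, Duke Math. J. 104 (2000), 45–73, §2, (2.3) and Lemma 2.2.
* W. Gontcharoff, *Recherches sur les dérivées successives des fonctions analytiques*, Ann. Sci.
  ÉNS 47 (1930), 1–78, pp. 11–13 (cited through Ki–Kim 2000, Remark 2.1).
-/

noncomputable section

open Complex Set Metric intervalIntegral

namespace Literature.Analysis.Complex

/-- **One integration along a segment.** If `f` is entire, `f(z₀) = 0` and
`‖f'(z₀ + t(w − z₀))‖ ≤ A (t‖w − z₀‖ + c)ⁿ` for `t ∈ [0, 1]` (`A, c ≥ 0`), then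
`‖f(w)‖ ≤ A (‖w − z₀‖ + c)^{n+1}/(n + 1)`
(`f(w) = (w − z₀)∫₀¹ f'(z₀ + t(w − z₀)) dt` and `∫₀¹ (td + c)ⁿ dt = ((d + c)^{n+1} − c^{n+1})/((n+1)d)`).
[cite: KiKim2000, §2 eq. (2.3)] -/
theorem norm_le_of_norm_deriv_le_segment {f : ℂ → ℂ} (hf : Differentiable ℂ f) {z₀ w : ℂ}
    (h0 : f z₀ = 0) {A c : ℝ} (hA : 0 ≤ A) (hc : 0 ≤ c) (n : ℕ)
    (hb : ∀ t ∈ Icc (0 : ℝ) 1,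
      ‖deriv f (z₀ + t • (w - z₀))‖ ≤ A * (‖w - z₀‖ * t + c) ^ n) :
    ‖f w‖ ≤ A * (‖w - z₀‖ + c) ^ (n + 1) / (n + 1) := by
  set d : ℝ := ‖w - z₀‖ with hd
  have hcont : ContinuousOn (fun t : ℝ ↦ deriv f (z₀ + t • (w - z₀))) (Icc 0 1) :=
    (hf.deriv.continuous.comp (by fun_prop)).continuousOn
  have hderiv : ∀ t ∈ Icc (0 : ℝ) 1,
      HasDerivAt f (deriv f (z₀ + t • (w - z₀))) (z₀ + t • (w - z₀)) :=
    fun t _ ↦ (hf _).hasDerivAt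
  have hftc := intervalIntegral.integral_unitInterval_deriv_eq_sub hcont hderiv
  have hfw : f w = (w - z₀) • ∫ t in (0 : ℝ)..1, deriv f (z₀ + t • (w - z₀)) := by
    rw [hftc, h0, sub_zero, add_sub_cancel]
  have hint : ‖∫ t in (0 : ℝ)..1, deriv f (z₀ + t • (w - z₀))‖ ≤
      ∫ t in (0 : ℝ)..1, A * (d * t + c) ^ n := by
    refine intervalIntegral.norm_integral_le_of_norm_le zero_le_one
      (Filter.Eventually.of_forall fun t ht ↦ hb t (Ioc_subset_Icc_self ht)) ?_
    exact (by fun_prop : Continuous fun t : ℝ ↦ A * (d * t + c) ^ n).intervalIntegrable _ _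
  have hn1 : (0 : ℝ) < n + 1 := by positivity
  rcases eq_or_lt_of_le (norm_nonneg (w - z₀)) with hd0 | hdpos
  · have hd00 : d = 0 := by rw [hd]; exact hd0.symm
    rw [hfw, norm_smul, ← hd, hd00, zero_mul]
    positivity
  · have hdne : d ≠ 0 := by rw [hd]; exact hdpos.ne'
    have hcalc : ∫ t in (0 : ℝ)..1, A * (d * t + c) ^ n =
        A * (d⁻¹ * (((d + c) ^ (n + 1) - c ^ (n + 1)) / (n + 1))) := by
      rw [intervalIntegral.integral_const_mul]
      congr 1
      have h := intervalIntegral.integral_comp_mul_add (a := (0 : ℝ)) (b := 1)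
        (f := fun x : ℝ ↦ x ^ n) hdpos.ne' c
      simp only [mul_zero, zero_add, mul_one, smul_eq_mul] at h
      rw [h, integral_pow]
    have hsub : ((d + c) ^ (n + 1) - c ^ (n + 1)) / (n + 1) ≤ (d + c) ^ (n + 1) / (n + 1) := by
      apply div_le_div_of_nonneg_right _ hn1.le
      have : 0 ≤ c ^ (n + 1) := by positivity
      linarith
    calc ‖f w‖ = d * ‖∫ t in (0 : ℝ)..1, deriv f (z₀ + t • (w - z₀))‖ := by
          rw [hfw, norm_smul, hd]
      _ ≤ d * (A * (d⁻¹ * (((d + c) ^ (n + 1) - c ^ (n + 1)) / (n + 1)))) := by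
          rw [← hcalc]; exact mul_le_mul_of_nonneg_left hint hdpos.le
      _ = A * (((d + c) ^ (n + 1) - c ^ (n + 1)) / (n + 1)) := by
          field_simp
      _ ≤ A * ((d + c) ^ (n + 1) / (n + 1)) := mul_le_mul_of_nonneg_left hsub hA
      _ = A * (d + c) ^ (n + 1) / (n + 1) := by ring

/-- **Gontcharoff's estimate (Ki–Kim 2000, §2, (2.3)).** Let `K ⊆ ℂ` be convex, `f` entire,
`z₀, …, z_j ∈ K` with `f^{(k)}(z_k) = 0` for `0 ≤ k ≤ j`, and `‖f^{(j+1)}‖ ≤ M` on `K`. Then for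
every `w ∈ K`,
`‖f(w)‖ ≤ M (‖w − z₀‖ + ∑_{k<j} ‖z_k − z_{k+1}‖)^{j+1} / (j+1)!`.
(The printed statement has `n = j + 1` and `M = M(|z| + |z − z₀| + ⋯ ; f^{(n)})`, the maximum
modulus on a disc about `0` containing the broken line; any convex `K` and bound `M` work.)
[cite: KiKim2000, §2 eq. (2.3)] -/
theorem gontcharoff_norm_le {K : Set ℂ} (hK : Convex ℝ K) (j : ℕ) :
    ∀ {f : ℂ → ℂ}, Differentiable ℂ f → ∀ z : ℕ → ℂ, (∀ k ≤ j, z k ∈ K) →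
      (∀ k ≤ j, iteratedDeriv k f (z k) = 0) →
      ∀ {M : ℝ}, (∀ u ∈ K, ‖iteratedDeriv (j + 1) f u‖ ≤ M) → ∀ {w : ℂ}, w ∈ K →
        ‖f w‖ ≤ M * (‖w - z 0‖ + ∑ k ∈ Finset.range j, ‖z k - z (k + 1)‖) ^ (j + 1) /
          (j + 1).factorial := by
  induction j with
  | zero =>
    intro f hf z hzK hzero M hM w hw
    have h0 : f (z 0) = 0 := by simpa using hzero 0 le_rfl
    have hM' : ∀ u ∈ K, ‖deriv f u‖ ≤ M := fun u hu ↦ by simpa [iteratedDeriv_one] using hM u hu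
    have h := hK.norm_image_sub_le_of_norm_deriv_le (fun u _ ↦ hf u) hM' (hzK 0 le_rfl) hw
    simpa [h0] using h
  | succ j ih =>
    intro f hf z hzK hzero M hM w hw
    have hg : Differentiable ℂ (deriv f) := hf.deriv
    have hgit : ∀ k, iteratedDeriv k (deriv f) = iteratedDeriv (k + 1) f := fun k ↦
      (iteratedDeriv_succ' (n := k) (f := f)).symm
    -- the inductive hypothesis for `f'` along the shifted chain
    have IH : ∀ {v : ℂ}, v ∈ K → ‖deriv f v‖ ≤
        M * (‖v - z 1‖ + ∑ k ∈ Finset.range j, ‖z (k + 1) - z (k + 1 + 1)‖) ^ (j + 1) /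
          (j + 1).factorial :=
      ih hg (fun k ↦ z (k + 1)) (fun k hk ↦ hzK (k + 1) (by omega))
        (fun k hk ↦ by rw [hgit]; exact hzero (k + 1) (by omega))
        (fun u hu ↦ by rw [hgit]; exact hM u hu)
    set c : ℝ := ‖z 0 - z 1‖ + ∑ k ∈ Finset.range j, ‖z (k + 1) - z (k + 1 + 1)‖ with hc
    have hc0 : 0 ≤ c := by positivity
    have hM0 : 0 ≤ M := (norm_nonneg _).trans (hM w hw)
    have h0 : f (z 0) = 0 := by simpa using hzero 0 (Nat.zero_le _)
    set d : ℝ := ‖w - z 0‖ with hd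
    -- the bound for `f'` on the segment `[z 0, w]`
    have hseg : ∀ t ∈ Icc (0 : ℝ) 1, ‖deriv f (z 0 + t • (w - z 0))‖ ≤
        M / (j + 1).factorial * (‖w - z 0‖ * t + c) ^ (j + 1) := by
      intro t ht
      have hmem : z 0 + t • (w - z 0) ∈ K := hK.add_smul_sub_mem (hzK 0 (Nat.zero_le _)) hw ht
      have hdist : ‖z 0 + t • (w - z 0) - z 1‖ ≤ ‖w - z 0‖ * t + ‖z 0 - z 1‖ := by
        calc ‖z 0 + t • (w - z 0) - z 1‖ = ‖t • (w - z 0) + (z 0 - z 1)‖ := by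
              congr 1; abel
          _ ≤ ‖t • (w - z 0)‖ + ‖z 0 - z 1‖ := norm_add_le _ _
          _ = ‖w - z 0‖ * t + ‖z 0 - z 1‖ := by
              rw [norm_smul, Real.norm_eq_abs, abs_of_nonneg ht.1, mul_comm]
      have hX : ‖z 0 + t • (w - z 0) - z 1‖ +
          ∑ k ∈ Finset.range j, ‖z (k + 1) - z (k + 1 + 1)‖ ≤ ‖w - z 0‖ * t + c := by
        rw [hc]; linarith
      calc ‖deriv f (z 0 + t • (w - z 0))‖
          ≤ M * (‖z 0 + t • (w - z 0) - z 1‖ +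
              ∑ k ∈ Finset.range j, ‖z (k + 1) - z (k + 1 + 1)‖) ^ (j + 1) / (j + 1).factorial :=
            IH hmem
        _ ≤ M * (‖w - z 0‖ * t + c) ^ (j + 1) / (j + 1).factorial := by
            gcongr
        _ = M / (j + 1).factorial * (‖w - z 0‖ * t + c) ^ (j + 1) := by ring
    have hres := norm_le_of_norm_deriv_le_segment hf h0 (by positivity) hc0 (j + 1) hseg
    -- bookkeeping: `(d + c)` is the full variation and `(j+2)(j+1)! = (j+2)!`
    have hsum : ‖w - z 0‖ + ∑ k ∈ Finset.range (j + 1), ‖z k - z (k + 1)‖ = ‖w - z 0‖ + c := by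
      rw [Finset.sum_range_succ', hc]; ring
    rw [hsum]
    calc ‖f w‖ ≤ M / (j + 1).factorial * (‖w - z 0‖ + c) ^ (j + 1 + 1) / ((j + 1 : ℕ) + 1) := hres
      _ = M * (‖w - z 0‖ + c) ^ (j + 1 + 1) / (j + 1 + 1).factorial := by
          rw [Nat.factorial_succ (j + 1)]
          push_cast
          field_simp

end Literature.Analysis.Complex
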